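import Literature.Computability.Cryptography.CubicClassTable
import Literature.NumberTheory.CubicFields.PureCubicLatticeCodes
import Mathlib.NumberTheory.NumberField.Basic
import Mathlib.RingTheory.FractionalIdeal.Basic
import HarnessLib

/-!
# The class-group table: named specifications of the arithmetic and reduction PROGRAMS (definitions)

Topic `Computability/Cryptography`; DEFINITIONS ONLY (named `Prop`s), third companion of `CubicClassTable.lean`. They name the
specifications that the landed program parts of the line `arakelov-giant-step-cycle` (crux `LinnikCubicClassGroups.PureCubicClassGroupFBQP`)
establish for the individual programs — the lexicographic cylinder minimum `lexE` (`LexMinSpec`), the certified logarithm `logE`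
(`LogSpec`), the inverse `invE` (`InvSpec`), scaling `latScale` (`ScaleSpec`), the product `latProd` (`ProdSpec`), the order code `ordL`
(`OrdSpec`) — and the OPERATIONAL EQUATIONS defining the walk programs from them: `RedLEq` (`redL = (latScale ∘ invE ∘ lexE, logE ∘ lexE)`),
`IsBigEq` (the big-gap test), `RhoSEq`, `StarSEq`, `UnitSEq` (the filtered loops). Written in the landed vocabulary
`PureCubicCodes.Canon/Mem/val` (`Literature/NumberTheory/CubicFields/PureCubicLatticeCodes.lean`), which is DEFINITIONALLY the
expanded text of the registered program stubs, so the landed theorems discharge these Props by unfolding. The semantics stub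
"programs ⇒ `RedSem ∧ UnitSem' ∧ LatProdSem`" is stated over these names. [Buchmann–Williams 1988, §3; Hallgren 2005, §4]

## References

* J. Buchmann, H. C. Williams, Math. Comp. 50 (1988), §3. [BuchmannWilliams1988]
* S. Hallgren, STOC 2005, §4. [Hallgren2005]
-/

noncomputable section

namespace Literature.Computability.Cryptography

namespace CubicClassTable

open Literature.NumberTheory.CubicFields (PureCubicCodes.Mem PureCubicCodes.Canon PureCubicCodes.val)
open scoped NumberField nonZeroDivisors

/-- **The lexicographic cylinder minimum**: on the canonical code of a nonzero fractional ideal, `lexE` returns an element of the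
lattice in the unit cylinder (`σ₁ > 0`, `|σ₂| < 1`) with least `σ₁`. [cite: BuchmannWilliams1988, §3] -/
def LexMinSpec (a b : ℕ) (K : Type*) [Field K] [NumberField K] (θ : K) (σ₁ : K →+* ℝ) (σ₂ : K →+* ℂ)
    (lexE : (ℕ × ℕ) × (ℕ × List ℤ) → ℤ × ℤ × ℤ × ℕ) : Prop :=
  ∀ c : ℕ × List ℤ, PureCubicCodes.Canon c →
    (∃ I : FractionalIdeal (𝓞 K)⁰ K, I ≠ 0 ∧ ∀ φ : K, PureCubicCodes.Mem θ b c φ ↔ φ ∈ I) →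
    1 ≤ (lexE ((a, b), c)).2.2.2 ∧
    PureCubicCodes.Mem θ b c (PureCubicCodes.val θ b (lexE ((a, b), c))) ∧
    0 < σ₁ (PureCubicCodes.val θ b (lexE ((a, b), c))) ∧
    ‖σ₂ (PureCubicCodes.val θ b (lexE ((a, b), c)))‖ < 1 ∧
    ∀ φ : K, PureCubicCodes.Mem θ b c φ → 0 < σ₁ φ → ‖σ₂ φ‖ < 1 →
      σ₁ (PureCubicCodes.val θ b (lexE ((a, b), c))) ≤ σ₁ φ

/-- **The certified logarithm**: `|logE − 2^prec log σ₁(e)| ≤ 1` whenever `σ₁(e) ≥ 2^-prec` (real cube roots written out).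
[cite: BuchmannWilliams1988, §3] -/
def LogSpec (a b : ℕ) (logE : (ℕ × ℕ) × ((ℤ × ℤ × ℤ × ℕ) × ℕ) → ℤ) : Prop :=
  ∀ (e : ℤ × ℤ × ℤ × ℕ) (prec : ℕ), 1 ≤ e.2.2.2 →
    (1 : ℝ) / 2 ^ prec ≤ ((((e).1 : ℤ) : ℝ) + (((e).2.1 : ℤ) : ℝ) * (((a * b ^ 2 : ℕ) : ℝ) ^ ((1 : ℝ) / 3)) +
          (((e).2.2.1 : ℤ) : ℝ) * (((a ^ 2 * b : ℕ) : ℝ) ^ ((1 : ℝ) / 3))) / (((e).2.2.2 : ℕ) : ℝ) →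
    |((logE ((a, b), (e, prec)) : ℤ) : ℝ) - 2 ^ prec * Real.log (((((e).1 : ℤ) : ℝ) + (((e).2.1 : ℤ) : ℝ) * (((a * b ^ 2 : ℕ) : ℝ) ^ ((1 : ℝ) / 3)) +
          (((e).2.2.1 : ℤ) : ℝ) * (((a ^ 2 * b : ℕ) : ℝ) ^ ((1 : ℝ) / 3))) / (((e).2.2.2 : ℕ) : ℝ))| ≤ 1

/-- **The inverse** of a nonzero element. [folklore] -/
def InvSpec (a b : ℕ) (K : Type*) [Field K] (θ : K) (invE : (ℕ × ℕ) × (ℤ × ℤ × ℤ × ℕ) → ℤ × ℤ × ℤ × ℕ) : Prop :=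
  ∀ e : ℤ × ℤ × ℤ × ℕ, 1 ≤ e.2.2.2 → PureCubicCodes.val θ b e ≠ 0 →
    1 ≤ (invE ((a, b), e)).2.2.2 ∧ PureCubicCodes.val θ b (invE ((a, b), e)) * PureCubicCodes.val θ b e = 1

/-- **Scaling a lattice by a nonzero element** (canonical code of `c · e`). [folklore] -/
def ScaleSpec (a b : ℕ) (K : Type*) [Field K] (θ : K)
    (latScale : (ℕ × ℕ) × ((ℕ × List ℤ) × (ℤ × ℤ × ℤ × ℕ)) → ℕ × List ℤ) : Prop :=
  ∀ (c : ℕ × List ℤ) (e : ℤ × ℤ × ℤ × ℕ), PureCubicCodes.Canon c → 1 ≤ e.2.2.2 → PureCubicCodes.val θ b e ≠ 0 →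
    PureCubicCodes.Canon (latScale ((a, b), (c, e))) ∧
    ∀ φ : K, PureCubicCodes.Mem θ b (latScale ((a, b), (c, e))) φ ↔
      ∃ ψ : K, PureCubicCodes.Mem θ b c ψ ∧ φ = ψ * PureCubicCodes.val θ b e

/-- **The lattice product** (canonical code of the `ℤ`-span of the products). [folklore] -/
def ProdSpec (a b : ℕ) (K : Type*) [Field K] (θ : K)
    (latProd : (ℕ × ℕ) × ((ℕ × List ℤ) × (ℕ × List ℤ)) → ℕ × List ℤ) : Prop :=
  ∀ c₁ c₂ : ℕ × List ℤ, PureCubicCodes.Canon c₁ → PureCubicCodes.Canon c₂ →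
    PureCubicCodes.Canon (latProd ((a, b), (c₁, c₂))) ∧
    ∀ φ : K, PureCubicCodes.Mem θ b (latProd ((a, b), (c₁, c₂))) φ ↔
      φ ∈ AddSubgroup.closure {ψ : K | ∃ ψ₁ ψ₂ : K, PureCubicCodes.Mem θ b c₁ ψ₁ ∧ PureCubicCodes.Mem θ b c₂ ψ₂ ∧ ψ = ψ₁ * ψ₂}

/-- **The order code**: `ordL (a,b)` is the canonical code of `𝓞_K`. [folklore] -/
def OrdSpec (a b : ℕ) (K : Type*) [Field K] (θ : K) (ordL : ℕ × ℕ → ℕ × List ℤ) : Prop :=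
  PureCubicCodes.Canon (ordL (a, b)) ∧ ∀ φ : K, PureCubicCodes.Mem θ b (ordL (a, b)) φ ↔ IsIntegral ℤ φ

/-- **Operational equation of the reduction step**: `redL = (latScale c (lexE c)⁻¹, logE (lexE c))`. [cite: BuchmannWilliams1988, §3] -/
def RedLEq (a b : ℕ) (K : Type*) [Field K] (θ : K)
    (lexE : (ℕ × ℕ) × (ℕ × List ℤ) → ℤ × ℤ × ℤ × ℕ) (logE : (ℕ × ℕ) × ((ℤ × ℤ × ℤ × ℕ) × ℕ) → ℤ)
    (invE : (ℕ × ℕ) × (ℤ × ℤ × ℤ × ℕ) → ℤ × ℤ × ℤ × ℕ)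
    (latScale : (ℕ × ℕ) × ((ℕ × List ℤ) × (ℤ × ℤ × ℤ × ℕ)) → ℕ × List ℤ)
    (redL : ((ℕ × ℕ) × ℕ) × (ℕ × List ℤ) → (ℕ × List ℤ) × ℤ) : Prop :=
  ∀ (prec : ℕ) (c : ℕ × List ℤ), 1 ≤ (lexE ((a, b), c)).2.2.2 → PureCubicCodes.val θ b (lexE ((a, b), c)) ≠ 0 →
    (redL (((a, b), prec), c)).1 = latScale ((a, b), (c, invE ((a, b), lexE ((a, b), c)))) ∧
    (redL (((a, b), prec), c)).2 = logE ((a, b), (lexE ((a, b), c), prec))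

/-- **Operational equation of the big-gap test**: `isBigL c ⇔ N(10·lexE c − 11) ≥ 0` (i.e. `σ₁ ≥ 11/10`). [folklore] -/
def IsBigEq (a b : ℕ) (K : Type*) [Field K] [NumberField K] (θ : K)
    (lexE : (ℕ × ℕ) × (ℕ × List ℤ) → ℤ × ℤ × ℤ × ℕ) (isBigL : (ℕ × ℕ) × (ℕ × List ℤ) → Bool) : Prop :=
  ∀ c : ℕ × List ℤ, 1 ≤ (lexE ((a, b), c)).2.2.2 →
    (isBigL ((a, b), c) = true ↔ 0 ≤ Algebra.norm ℚ ((10 : K) * PureCubicCodes.val θ b (lexE ((a, b), c)) - 11))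

/-- **Operational equation of the filtered baby step** (≤ 7 reduction steps, stop at a big gap). [cite: Hallgren2005, §4] -/
def RhoSEq (redL : ((ℕ × ℕ) × ℕ) × (ℕ × List ℤ) → (ℕ × List ℤ) × ℤ) (isBigL : (ℕ × ℕ) × (ℕ × List ℤ) → Bool)
    (rhoS : ((ℕ × ℕ) × ℕ) × (ℕ × List ℤ) → (ℕ × List ℤ) × ℤ) : Prop :=
  ∀ (a b prec : ℕ) (c : ℕ × List ℤ), rhoS (((a, b), prec), c) =
        (((fun s : ((ℕ × List ℤ) × ℤ) × Bool => if s.2 = true then s else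
            (((redL (((a, b), prec), s.1.1)).1, s.1.2 + (redL (((a, b), prec), s.1.1)).2), isBigL ((a, b), (redL (((a, b), prec), s.1.1)).1))))^[7]
          ((c, 0), false)).1

/-- **Operational equation of the filtered giant step** (product, then ≤ 7 reduction steps, stop at a big gap).
[cite: Hallgren2005, §4] -/
def StarSEq (redL : ((ℕ × ℕ) × ℕ) × (ℕ × List ℤ) → (ℕ × List ℤ) × ℤ) (isBigL : (ℕ × ℕ) × (ℕ × List ℤ) → Bool)
    (latProd : (ℕ × ℕ) × ((ℕ × List ℤ) × (ℕ × List ℤ)) → ℕ × List ℤ)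
    (starS : ((ℕ × ℕ) × ℕ) × ((ℕ × List ℤ) × (ℕ × List ℤ)) → (ℕ × List ℤ) × ℤ) : Prop :=
  ∀ (a b prec : ℕ) (c₁ c₂ : ℕ × List ℤ), starS (((a, b), prec), (c₁, c₂)) =
        (((fun s : ((ℕ × List ℤ) × ℤ) × Bool => if s.2 = true then s else
            (((redL (((a, b), prec), s.1.1)).1, s.1.2 + (redL (((a, b), prec), s.1.1)).2), isBigL ((a, b), (redL (((a, b), prec), s.1.1)).1))))^[6]
          (((redL (((a, b), prec), latProd ((a, b), (c₁, c₂)))).1, (redL (((a, b), prec), latProd ((a, b), (c₁, c₂)))).2),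
            isBigL ((a, b), (redL (((a, b), prec), latProd ((a, b), (c₁, c₂)))).1))).1

/-- **Operational equation of the first big-gap point** (≤ 6 reduction steps from `𝓞_K`, stop at a big gap). [cite: Hallgren2005, §4] -/
def UnitSEq (redL : ((ℕ × ℕ) × ℕ) × (ℕ × List ℤ) → (ℕ × List ℤ) × ℤ) (isBigL : (ℕ × ℕ) × (ℕ × List ℤ) → Bool)
    (ordL : ℕ × ℕ → ℕ × List ℤ) (unitS : (ℕ × ℕ) × ℕ → (ℕ × List ℤ) × ℤ) : Prop :=
  ∀ (a b prec : ℕ), unitS ((a, b), prec) =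
        (((fun s : ((ℕ × List ℤ) × ℤ) × Bool => if s.2 = true then s else
            (((redL (((a, b), prec), s.1.1)).1, s.1.2 + (redL (((a, b), prec), s.1.1)).2), isBigL ((a, b), (redL (((a, b), prec), s.1.1)).1))))^[6]
          ((ordL (a, b), 0), isBigL ((a, b), ordL (a, b)))).1

end CubicClassTable

end Literature.Computability.Cryptography
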